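import Summits.CriticalPhenomena.PercolationContinuityZ3.Theorems.Transplant.SharpnessGridCoarse
import Literature.Probability.Percolation.BernoulliPercolation
import Mathlib.MeasureTheory.Measure.Real
import HarnessLib

/-!
# Transplant sharpness IX — Peierls' path counting for the mesh-`M` coarse configuration

builds on p205010 (kernel theorem, internal audit signed; external expert review pending).
Status sentence (coordinator 2026-08-20T04:30Z): "θ(p_c) = 0 on ℤ^d, all d ≥ 2 — kernel-verified (Lean 4/Mathlib,
standard axioms); internal adversarial audit SIGNED 2026-08-20 04:29Z; external expert review pending."

Lane `prim-bschramm`, seat p5 (sharpness); memo `run/shared/lean/prim/bschramm/prim-bschramm-p5-g19/GRIDWEDGE-PROOF.md`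
§4.2 (R)/(C) and §7 (M2), §7.1 (D4).  Module (M2a) of the kernel route for the hard half of P5-SHARPNESS row 83.
Everything is PROVED.  Under `P_p` on `ℤ²` the coarse edges of `coarseConfig M ω` (a coarse edge is open iff all `M`
edges of its wall are open) are independent with probability `p^M` each, because distinct walls are disjoint sets of
`M` lattice edges (`card_wallSet`, `disjoint_wallSet`); hence (Peierls, Grimmett 1999 §1.4 (1.14)–(1.15) on the
renormalised lattice):

* `wordEdgeSet`, `real_wordEvent` — for a word `w ∈ ({0,1} × {±})ⁿ` whose positions from the cell `x` are pairwise
  distinct, the probability that all `n` coarse edges along it are open is `(p^M)ⁿ`;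
* `coarsePathEvent_subset_iUnion`, `real_coarsePathEvent_le` — the event "there is a self-avoiding walk of `n` OPEN
  coarse edges starting at the cell `x`" has probability `≤ (4 p^M)ⁿ`.

References: G. Grimmett, *Percolation*, 2nd ed. (1999), §1.4, (1.14)–(1.16) (path counting); H. Kesten,
*Percolation Theory for Mathematicians* (1982), §2.2.
-/

noncomputable section

namespace Summit.CriticalPhenomena.PercolationContinuityZ3.Theorems.TransplantSharpness

open MeasureTheory Literature.Probability.Percolation Literature.Probability.LatticeModels

/-! ## Walls as finite edge sets -/

/-- The wall of the coarse edge `{x, x + e_j}` as a finite set of `M` lattice edges. House notation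
(GRIDWEDGE-PROOF §4.2). -/
def wallSet (M : ℕ) (x : Site 2) (j : Fin 2) : Finset (Sym2 (Site 2)) :=
  (Finset.range M).image (wallEdge M x j)

/-- A coarse edge is open iff its wall is contained in the configuration. [folklore] -/
theorem unitEdge_mem_coarseConfig_iff_wallSet {M : ℕ} {ω : BondConfig (Site 2)} {x : Site 2} {j : Fin 2} :
    s(x, x + Pi.single j (1 : ℤ)) ∈ coarseConfig M ω ↔ (↑(wallSet M x j) : Set (Sym2 (Site 2))) ⊆ ω := by
  rw [unitEdge_mem_coarseConfig_iff]
  simp only [wallSet, Finset.coe_image, Finset.coe_range, Set.image_subset_iff]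
  constructor
  · intro h t ht; exact h t (Set.mem_Iio.1 ht)
  · intro h t ht; exact h (Set.mem_Iio.2 ht)

/-- Walls consist of lattice edges. [folklore] -/
theorem wallSet_subset_edgeSet (M : ℕ) (x : Site 2) (j : Fin 2) :
    (↑(wallSet M x j) : Set (Sym2 (Site 2))) ⊆ (zdGraph 2).edgeSet := by
  intro e he
  rw [wallSet, Finset.coe_image] at he
  obtain ⟨t, -, rfl⟩ := he
  exact wallEdge_mem_edgeSet M x j t

/-- A multiple of `M` plus a remainder in `[0, M)` determines both. [folklore] -/
theorem eq_of_mul_add_eq {M : ℕ} {a b : ℤ} {t t' : ℕ} (ht : t < M) (ht' : t' < M)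
    (h : (M : ℤ) * a + t = (M : ℤ) * b + t') : a = b ∧ t = t' := by
  have hM : (0 : ℤ) < M := by exact_mod_cast (Nat.zero_le t).trans_lt ht
  have h1 : ((M : ℤ) * a + t) % M = t := by
    rw [add_comm, Int.add_mul_emod_self_left, Int.emod_eq_of_lt (by omega) (by omega)]
  have h2 : ((M : ℤ) * b + t') % M = t' := by
    rw [add_comm, Int.add_mul_emod_self_left, Int.emod_eq_of_lt (by omega) (by omega)]
  have htt : (t : ℤ) = t' := by rw [← h1, ← h2, h]
  have hab : (M : ℤ) * a = (M : ℤ) * b := by omega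
  exact ⟨mul_left_cancel₀ hM.ne' hab, by exact_mod_cast htt⟩

/-- **Walls of distinct coarse edges are disjoint; each wall edge determines its coarse edge and its index.** [folklore] -/
theorem wallEdge_inj {M : ℕ} {x x' : Site 2} {j j' : Fin 2} {t t' : ℕ} (ht : t < M) (ht' : t' < M)
    (h : wallEdge M x j t = wallEdge M x' j' t') : x = x' ∧ j = j' ∧ t = t' := by
  unfold wallEdge at h
  have h' : s((M : ℤ) • x + Pi.single j (t : ℤ), (M : ℤ) • x + Pi.single j (t : ℤ) + Pi.single j (1 : ℤ)) =
      s((M : ℤ) • x' + Pi.single j' (t' : ℤ), (M : ℤ) • x' + Pi.single j' (t' : ℤ) + Pi.single j' (1 : ℤ)) := by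
    rw [add_assoc, ← Pi.single_add, add_assoc, ← Pi.single_add]; exact h
  obtain ⟨hbase, hjj⟩ := eq_of_unitEdge_eq h'
  subst hjj
  -- compare coordinates
  have hj := congr_fun hbase j
  simp only [Pi.add_apply, Pi.smul_apply, smul_eq_mul, Pi.single_eq_same] at hj
  obtain ⟨hxj, htt⟩ := eq_of_mul_add_eq ht ht' hj
  refine ⟨?_, rfl, htt⟩
  ext i
  rcases eq_or_ne i j with rfl | hij
  · exact hxj
  · have hi := congr_fun hbase i
    simp only [Pi.add_apply, Pi.smul_apply, smul_eq_mul, Pi.single_eq_of_ne hij, add_zero] at hi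
    have hM : (0 : ℤ) < M := by exact_mod_cast (Nat.zero_le t).trans_lt ht
    exact mul_left_cancel₀ hM.ne' hi

/-- A wall has exactly `M` edges. [folklore] -/
theorem card_wallSet (M : ℕ) (x : Site 2) (j : Fin 2) : (wallSet M x j).card = M := by
  rw [wallSet, Finset.card_image_of_injOn, Finset.card_range]
  intro t ht t' ht' h
  exact (wallEdge_inj (Finset.mem_range.1 ht) (Finset.mem_range.1 ht') h).2.2

/-- Distinct coarse edges have disjoint walls. [folklore] -/
theorem disjoint_wallSet {M : ℕ} {x x' : Site 2} {j j' : Fin 2} (h : x ≠ x' ∨ j ≠ j') :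
    Disjoint (wallSet M x j) (wallSet M x' j') := by
  rw [Finset.disjoint_left]
  intro e he he'
  rw [wallSet, Finset.mem_image] at he he'
  obtain ⟨t, ht, rfl⟩ := he
  obtain ⟨t', ht', heq⟩ := he'
  obtain ⟨hx, hj, -⟩ := wallEdge_inj (Finset.mem_range.1 ht') (Finset.mem_range.1 ht) heq
  rcases h with h | h
  · exact h hx.symm
  · exact h hj.symm

/-! ## Coarse steps as unit edges -/

/-- The lower endpoint of the coarse edge traversed by the step from `a` in direction `dir`. [folklore] -/
def stepBase (a : Site 2) (dir : Fin 2 × Bool) : Site 2 :=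
  if dir.2 then a else a + stepVec dir

/-- The step `{a, a + stepVec dir}` is the unit edge `{stepBase, stepBase + e_{dir.1}}`. [folklore] -/
theorem step_edge_eq (a : Site 2) (dir : Fin 2 × Bool) :
    s(a, a + stepVec dir) = s(stepBase a dir, stepBase a dir + Pi.single dir.1 (1 : ℤ)) := by
  obtain ⟨i, b⟩ := dir
  cases b
  · simp only [stepBase, stepVec, Bool.false_eq_true, if_false]
    rw [Sym2.eq_swap]
    congr 1
    rw [add_assoc, neg_add_cancel, add_zero]
  · simp [stepBase, stepVec]

/-! ## Words of coarse steps -/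

/-- The edges of the `n` walls along the word `w` started at the cell `x`. House notation (GRIDWEDGE-PROOF §7.1 (D4)). -/
def wordEdgeSet (M : ℕ) (x : Site 2) {n : ℕ} (w : Fin n → Fin 2 × Bool) : Finset (Sym2 (Site 2)) :=
  Finset.univ.biUnion fun k : Fin n =>
    wallSet M (stepBase (x + wordPos w k) (w k)) (w k).1

/-- The word event: all walls along `w` from `x` are contained in the configuration. House notation. -/
def wordEvent (M : ℕ) (x : Site 2) {n : ℕ} (w : Fin n → Fin 2 × Bool) : Set (BondConfig (Site 2)) :=
  {ω | (↑(wordEdgeSet M x w) : Set (Sym2 (Site 2))) ⊆ ω}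

/-- Distinct steps of a self-avoiding word traverse distinct coarse edges. [folklore] -/
theorem stepBase_ne_of_wordInj {x : Site 2} {n : ℕ} {w : Fin n → Fin 2 × Bool} (hw : Set.InjOn (fun k : ℕ => x + wordPos w k) {k | k ≤ n})
    {k l : Fin n} (hkl : k ≠ l) :
    stepBase (x + wordPos w k) (w k) ≠ stepBase (x + wordPos w l) (w l) ∨ (w k).1 ≠ (w l).1 := by
  by_contra hcon
  rw [not_or, not_ne_iff, not_ne_iff] at hcon
  obtain ⟨hb, hj⟩ := hcon
  -- the two unit edges coincide, hence the two steps coincide as unordered pairs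
  have hk1 := wordPos_succ w k.2
  have hl1 := wordPos_succ w l.2
  have he : s(x + wordPos w k, x + wordPos w (k + 1)) = s(x + wordPos w l, x + wordPos w (l + 1)) := by
    rw [hk1, hl1, ← add_assoc, ← add_assoc, step_edge_eq, step_edge_eq, hb, hj]
  rw [Sym2.eq_iff] at he
  have hk0 : (k : ℕ) ∈ {i | i ≤ n} := Nat.le_of_lt k.2
  have hl0 : (l : ℕ) ∈ {i | i ≤ n} := Nat.le_of_lt l.2
  have hk1' : (k : ℕ) + 1 ∈ {i | i ≤ n} := k.2
  have hl1' : (l : ℕ) + 1 ∈ {i | i ≤ n} := l.2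
  rcases he with ⟨h1, -⟩ | ⟨h1, h2⟩
  · exact hkl (Fin.ext (hw hk0 hl0 h1))
  · have e1 : (k : ℕ) = l + 1 := hw hk0 hl1' h1
    have e2 : (k : ℕ) + 1 = l := hw hk1' hl0 h2
    omega

/-- For a self-avoiding word the `n` walls are pairwise disjoint, so `|wordEdgeSet| = n M`. [folklore] -/
theorem card_wordEdgeSet {M : ℕ} {x : Site 2} {n : ℕ} {w : Fin n → Fin 2 × Bool} (hw : Set.InjOn (fun k : ℕ => x + wordPos w k) {k | k ≤ n}) :
    (wordEdgeSet M x w).card = n * M := by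
  rw [wordEdgeSet, Finset.card_biUnion]
  · simp [card_wallSet]
  · intro k _ l _ hkl
    exact disjoint_wallSet (stepBase_ne_of_wordInj hw hkl)

/-- Word edge sets consist of lattice edges. [folklore] -/
theorem wordEdgeSet_subset_edgeSet (M : ℕ) (x : Site 2) {n : ℕ} (w : Fin n → Fin 2 × Bool) :
    (↑(wordEdgeSet M x w) : Set (Sym2 (Site 2))) ⊆ (zdGraph 2).edgeSet := by
  intro e he
  rw [wordEdgeSet, Finset.coe_biUnion] at he
  simp only [Finset.coe_univ, Set.mem_univ, Set.iUnion_true, Set.mem_iUnion] at he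
  obtain ⟨k, hk⟩ := he
  exact wallSet_subset_edgeSet M _ _ hk

/-- **The probability of a self-avoiding word event is `(p^M)ⁿ`.** [folklore] -/
theorem real_wordEvent {M : ℕ} (p : unitInterval) {x : Site 2} {n : ℕ} {w : Fin n → Fin 2 × Bool}
    (hw : Set.InjOn (fun k : ℕ => x + wordPos w k) {k | k ≤ n}) :
    (bondPercolation (zdGraph 2) p).real (wordEvent M x w) = ((p : ℝ) ^ M) ^ n := by
  rw [wordEvent, bondPercolation_real_setOf_subset _ _ _ (wordEdgeSet_subset_edgeSet M x w), card_wordEdgeSet hw,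
    ← pow_mul, mul_comm]

/-! ## The self-avoiding coarse path event and its Peierls bound -/

/-- The event "from the cell `x` starts a self-avoiding walk of at least `n` OPEN coarse edges" (for configurations
carried by the lattice edges). House notation (GRIDWEDGE-PROOF §7.1 (D4)). -/
def coarsePathEvent (M n : ℕ) (x : Site 2) : Set (BondConfig (Site 2)) :=
  {ω | ω ⊆ (zdGraph 2).edgeSet ∧
    ∃ (y : Site 2) (W : (openGraph (coarseConfig M ω)).Walk x y), W.IsPath ∧ n ≤ W.length}

/-- The direction of a coarse step. [folklore] -/
theorem exists_dir_of_adj {M : ℕ} {ω : BondConfig (Site 2)} {a b : Site 2}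
    (h : (openGraph (coarseConfig M ω)).Adj a b) : ∃ dir : Fin 2 × Bool, b = a + stepVec dir := by
  rw [openGraph_adj] at h
  have he : s(a, b) ∈ (zdGraph 2).edgeSet := coarseConfig_subset_edgeSet M ω h.1
  rw [SimpleGraph.mem_edgeSet, zdGraph_adj_iff_stepVec] at he
  exact he

/-- **A self-avoiding open coarse path of length `≥ n` from `x` realises some self-avoiding word event.** [folklore] -/
theorem coarsePathEvent_subset_iUnion (M n : ℕ) (x : Site 2) :
    coarsePathEvent M n x ⊆ ⋃ w ∈ {w : Fin n → Fin 2 × Bool | Set.InjOn (fun k : ℕ => x + wordPos w k) {k | k ≤ n}}, wordEvent M x w := by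
  classical
  rintro ω ⟨-, y, W, hW, hn⟩
  -- the directions of the first `n` steps
  have hdir : ∀ k : Fin n, ∃ dir : Fin 2 × Bool, W.getVert (k + 1) = W.getVert k + stepVec dir :=
    fun k => exists_dir_of_adj (W.adj_getVert_succ (lt_of_lt_of_le k.2 hn))
  choose w hw using hdir
  -- positions
  have hpos : ∀ k : ℕ, k ≤ n → x + wordPos w k = W.getVert k := by
    intro k
    induction k with
    | zero => intro; simp [W.getVert_zero]
    | succ k ih =>
      intro hk
      rw [wordPos_succ w (Nat.lt_of_succ_le hk), ← add_assoc, ih (Nat.le_of_succ_le hk)]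
      exact (hw ⟨k, Nat.lt_of_succ_le hk⟩).symm
  have hinj : Set.InjOn (fun k : ℕ => x + wordPos w k) {k | k ≤ n} := by
    intro k hk l hl hkl
    simp only [Set.mem_setOf_eq] at hk hl
    simp only [hpos k hk, hpos l hl] at hkl
    exact hW.getVert_injOn (hk.trans hn) (hl.trans hn) hkl
  simp only [Set.mem_iUnion, Set.mem_setOf_eq, exists_prop]
  refine ⟨w, hinj, ?_⟩
  -- every wall along the word is open
  show (↑(wordEdgeSet M x w) : Set (Sym2 (Site 2))) ⊆ ω
  rw [wordEdgeSet, Finset.coe_biUnion]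
  simp only [Finset.coe_univ, Set.mem_univ, Set.iUnion_true, Set.iUnion_subset_iff]
  intro k
  have hadj := W.adj_getVert_succ (lt_of_lt_of_le k.2 hn)
  rw [openGraph_adj] at hadj
  have hstep := hadj.1
  rw [hw k, ← hpos k (Nat.le_of_lt k.2), step_edge_eq, unitEdge_mem_coarseConfig_iff_wallSet] at hstep
  exact hstep

/-- The word events are measurable (cylinder events). [folklore] -/
theorem measurableSet_wordEvent (M : ℕ) (x : Site 2) {n : ℕ} (w : Fin n → Fin 2 × Bool) :
    MeasurableSet (wordEvent M x w) := by
  have : wordEvent M x w = ⋂ e ∈ wordEdgeSet M x w, {ω : BondConfig (Site 2) | e ∈ ω} := by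
    ext ω; simp [wordEvent, Set.subset_def]
  rw [this]
  exact MeasurableSet.biInter (Finset.countable_toSet _) fun e _ => measurableSet_mem e

/-- **Peierls' bound on the renormalised lattice**: the probability that some self-avoiding walk of `≥ n` open
coarse edges starts at the cell `x` is at most `(4 p^M)ⁿ` (at most `4ⁿ` words, each self-avoiding one of probability
`(p^M)ⁿ`; Grimmett 1999 §1.4 (1.14)–(1.16)). [folklore] -/
theorem real_coarsePathEvent_le (M n : ℕ) (p : unitInterval) (x : Site 2) :
    (bondPercolation (zdGraph 2) p).real (coarsePathEvent M n x) ≤ (4 * (p : ℝ) ^ M) ^ n := by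
  classical
  set μ := bondPercolation (zdGraph 2) p
  set I : Finset (Fin n → Fin 2 × Bool) := Finset.univ.filter fun w : Fin n → Fin 2 × Bool => Set.InjOn (fun k : ℕ => x + wordPos w k) {k | k ≤ n} with hI
  have hsub : coarsePathEvent M n x ⊆ ⋃ w ∈ I, wordEvent M x w := by
    refine (coarsePathEvent_subset_iUnion M n x).trans ?_
    intro ω hω
    simp only [Set.mem_iUnion, Set.mem_setOf_eq, exists_prop] at hω
    obtain ⟨w, hw, hωw⟩ := hω
    simp only [Set.mem_iUnion, exists_prop]
    exact ⟨w, by simp [hI, hw], hωw⟩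
  calc μ.real (coarsePathEvent M n x)
      ≤ μ.real (⋃ w ∈ I, wordEvent M x w) := measureReal_mono hsub (measure_ne_top _ _)
    _ ≤ ∑ w ∈ I, μ.real (wordEvent M x w) := measureReal_biUnion_finset_le I _
    _ = ∑ w ∈ I, ((p : ℝ) ^ M) ^ n := Finset.sum_congr rfl fun w hw => by
        have hw' : Set.InjOn (fun k : ℕ => x + wordPos w k) {k | k ≤ n} := (Finset.mem_filter.1 hw).2
        exact real_wordEvent p hw'
    _ = I.card * ((p : ℝ) ^ M) ^ n := by rw [Finset.sum_const, nsmul_eq_mul]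
    _ ≤ (4 : ℝ) ^ n * ((p : ℝ) ^ M) ^ n := by
        have hcard : I.card ≤ Fintype.card (Fin n → Fin 2 × Bool) := Finset.card_le_univ I
        rw [Fintype.card_fun, Fintype.card_fin, Fintype.card_prod, Fintype.card_fin, Fintype.card_bool] at hcard
        have hcard' : (I.card : ℝ) ≤ (4 : ℝ) ^ n := by exact_mod_cast hcard
        exact mul_le_mul_of_nonneg_right hcard' (pow_nonneg (pow_nonneg p.2.1 _) _)
    _ = (4 * (p : ℝ) ^ M) ^ n := by rw [mul_pow]

end Summit.CriticalPhenomena.PercolationContinuityZ3.Theorems.TransplantSharpness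

end
-- build-touch 2026-08-25T07:10Z T1-B (lead g18): re-land of p385650, declarations byte-identical
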